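import Summits.KontsevichZagierPeriods.KontsevichZagierPeriods.Theorems.UnfoldedStokesStokesGenerationFibrewiseRungDimOneAngular
import Literature.NumberTheory.Transcendental.KZSemialgebraicComplex
import Literature.NumberTheory.Transcendental.SemialgebraicLineDeriv
import Mathlib.Analysis.Calculus.Deriv.Mul
import Mathlib.Analysis.Calculus.Deriv.Add

/-!
# `StokesGeneration` (stmt-KontsevichZagierPeriods-3586) — line `fibrewise_stokes`, stub `stub_saLoopZPow`

Registered rung stub X8 (rung 10) of the line `fibrewise_stokes` of the crux `StokesGeneration`
(route UnfoldedStokes): **integer powers of semialgebraic `C¹` loops.** This is the function-class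
version of `stub_loopZPow` (rung 8, W2, polynomial loops). A LOOP here is a pair of real functions
`(A, B)` on `[0,1]` — the complex loop `P = A + iB` — together with derivative data `(A', B')`:
`A, B, A', B'` are continuous on `[0,1]`, read on the coordinate of `ℝ¹` they are `ℚ`-semialgebraic on
the closed unit cube of `ℝ¹`, `A' u`, `B' u` are the derivatives of `A`, `B` at every `u ∈ (0,1)`, and
`A² + B² ≠ 0` on `[0,1]`. Given finitely many loops `(Aₖ, Bₖ, Aₖ', Bₖ')` and integers `Nₖ` there is ONE
loop `(P, Q, P', Q')` of the same class whose angular derivative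
`Im(P′/P) = (P Q' − P' Q)/(P² + Q²)` equals `Σₖ Nₖ · (Aₖ Bₖ' − Aₖ' Bₖ)/(Aₖ² + Bₖ²)` on `[0,1]`, namely
`Π_{Nₖ ≥ 0} (Aₖ + iBₖ)^{Nₖ} · Π_{Nₖ < 0} (Aₖ − iBₖ)^{−Nₖ}`.

Everything is done with REAL pairs (no complex numbers), exactly as in the polynomial stub:

* product loop `(A₁A₂ − B₁B₂, A₁B₂ + B₁A₂)` with the Leibniz derivatives:
  `P² + Q² = (A₁² + B₁²)(A₂² + B₂²)` and the angular derivatives add;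
* conjugate loop `(A, −B, A', −B')`: the angular derivative changes sign;
* natural powers by iterating the product from the constant loop `(1, 0, 0, 0)`, integer powers via
  the conjugate, and the stub by induction on the number of loops (`Fin.sum_univ_castSucc`).

Semialgebraicity is preserved by pointwise ring operations (Bochnak–Coste–Roy 1998, Prop. 2.2.6, the
tree's `IsSemialgebraicFunOn.fun_mul/.fun_add/.fun_sub/.fun_neg`), continuity and derivatives by the
usual rules. [folklore]
-/

noncomputable section

set_option linter.dupNamespace false

namespace Summit.KontsevichZagierPeriods.KontsevichZagierPeriods.Cruxes.StokesGeneration.FibrewiseStokes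

open MeasureTheory Set Literature.NumberTheory.Transcendental Literature.NumberTheory.Transcendental.KZ
open Literature.ModelTheory.ExponentialFields (IsSemialgebraic)

/-! ## Product and conjugate of loops, pointwise -/

/-- Squared modulus of the product loop `(a₁ + ib₁)(a₂ + ib₂) = (a₁a₂ − b₁b₂) + i(a₁b₂ + b₁a₂)`:
it is the product of the squared moduli. [folklore] -/
theorem saLoopZPow_mul_normSq (a₁ b₁ a₂ b₂ : ℝ) :
    (a₁ * a₂ - b₁ * b₂) ^ 2 + (a₁ * b₂ + b₁ * a₂) ^ 2 = (a₁ ^ 2 + b₁ ^ 2) * (a₂ ^ 2 + b₂ ^ 2) := by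
  ring

/-- Angular derivative of the product loop, pointwise: with the Leibniz derivatives
`(a₁a₂ − b₁b₂)' = a₁'a₂ + a₁a₂' − (b₁'b₂ + b₁b₂')`, `(a₁b₂ + b₁a₂)' = a₁'b₂ + a₁b₂' + (b₁'a₂ + b₁a₂')`,
`Im((PQ)′/(PQ)) = Im(P′/P) + Im(Q′/Q)` wherever `P, Q ≠ 0`. [folklore] -/
theorem saLoopZPow_mul_ang (a₁ b₁ a₁' b₁' a₂ b₂ a₂' b₂' : ℝ)
    (h₁ : a₁ ^ 2 + b₁ ^ 2 ≠ 0) (h₂ : a₂ ^ 2 + b₂ ^ 2 ≠ 0) :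
    ((a₁ * a₂ - b₁ * b₂) * (a₁' * b₂ + a₁ * b₂' + (b₁' * a₂ + b₁ * a₂')) -
        (a₁' * a₂ + a₁ * a₂' - (b₁' * b₂ + b₁ * b₂')) * (a₁ * b₂ + b₁ * a₂)) /
      ((a₁ * a₂ - b₁ * b₂) ^ 2 + (a₁ * b₂ + b₁ * a₂) ^ 2) =
    (a₁ * b₁' - a₁' * b₁) / (a₁ ^ 2 + b₁ ^ 2) + (a₂ * b₂' - a₂' * b₂) / (a₂ ^ 2 + b₂ ^ 2) := by
  rw [saLoopZPow_mul_normSq, div_add_div _ _ h₁ h₂, div_left_inj' (mul_ne_zero h₁ h₂)]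
  ring

/-- Angular derivative of the conjugate loop `(a, −b)` with derivatives `(a', −b')`: it is minus that of
`(a, b)`. [folklore] -/
theorem saLoopZPow_conj_ang (a b a' b' : ℝ) :
    (a * -b' - a' * -b) / (a ^ 2 + (-b) ^ 2) = -((a * b' - a' * b) / (a ^ 2 + b ^ 2)) := by
  rw [neg_sq, ← neg_div]
  ring

/-! ## The constant loop, products, natural and integer powers of loops -/

/-- The constant loop `(1, 0)` with derivatives `(0, 0)` is a loop of the class (semialgebraic on any
`ℚ`-semialgebraic `S ⊆ ℝ¹`, continuous, differentiable, zero-free) with angular derivative `0`.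
[folklore] -/
theorem saLoopZPow_exists_const {S : Set (Fin 1 → ℝ)} (hS : IsSemialgebraic ℚ S) {f : ℝ → ℝ}
    (hf : ∀ u ∈ Icc (0:ℝ) 1, f u = 0) :
    ∃ (P Q P' Q' : ℝ → ℝ),
      IsSemialgebraicFunOn ℚ S (fun z => P (z 0)) ∧ IsSemialgebraicFunOn ℚ S (fun z => Q (z 0)) ∧
      IsSemialgebraicFunOn ℚ S (fun z => P' (z 0)) ∧ IsSemialgebraicFunOn ℚ S (fun z => Q' (z 0)) ∧
      ContinuousOn P (Icc (0:ℝ) 1) ∧ ContinuousOn Q (Icc (0:ℝ) 1) ∧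
      ContinuousOn P' (Icc (0:ℝ) 1) ∧ ContinuousOn Q' (Icc (0:ℝ) 1) ∧
      (∀ u ∈ Ioo (0:ℝ) 1, HasDerivAt P (P' u) u) ∧ (∀ u ∈ Ioo (0:ℝ) 1, HasDerivAt Q (Q' u) u) ∧
      (∀ u ∈ Icc (0:ℝ) 1, P u ^ 2 + Q u ^ 2 ≠ 0) ∧
      ∀ u ∈ Icc (0:ℝ) 1, (P u * Q' u - P' u * Q u) / (P u ^ 2 + Q u ^ 2) = f u :=
  ⟨fun _ => 1, fun _ => 0, fun _ => 0, fun _ => 0,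
    isSemialgebraicFunOn_const_of_isAlgebraic hS isAlgebraic_one,
    isSemialgebraicFunOn_const_of_isAlgebraic hS isAlgebraic_zero,
    isSemialgebraicFunOn_const_of_isAlgebraic hS isAlgebraic_zero,
    isSemialgebraicFunOn_const_of_isAlgebraic hS isAlgebraic_zero,
    continuousOn_const, continuousOn_const, continuousOn_const, continuousOn_const,
    fun u _ => hasDerivAt_const u 1, fun u _ => hasDerivAt_const u 0,
    fun u _ => by norm_num, fun u hu => by rw [hf u hu]; simp⟩

/-- Product of two loops of the class: again a loop of the class (parts `A₁A₂ − B₁B₂`, `A₁B₂ + B₁A₂`,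
derivatives by the Leibniz rule), and its angular derivative on `[0,1]` is the sum of the two angular
derivatives. [folklore] -/
theorem saLoopZPow_exists_mul {S : Set (Fin 1 → ℝ)}
    {A₁ B₁ A₁' B₁' A₂ B₂ A₂' B₂' f₁ f₂ : ℝ → ℝ}
    (sA₁ : IsSemialgebraicFunOn ℚ S (fun z => A₁ (z 0))) (sB₁ : IsSemialgebraicFunOn ℚ S (fun z => B₁ (z 0)))
    (sA₁' : IsSemialgebraicFunOn ℚ S (fun z => A₁' (z 0)))
    (sB₁' : IsSemialgebraicFunOn ℚ S (fun z => B₁' (z 0)))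
    (cA₁ : ContinuousOn A₁ (Icc (0:ℝ) 1)) (cB₁ : ContinuousOn B₁ (Icc (0:ℝ) 1))
    (cA₁' : ContinuousOn A₁' (Icc (0:ℝ) 1)) (cB₁' : ContinuousOn B₁' (Icc (0:ℝ) 1))
    (dA₁ : ∀ u ∈ Ioo (0:ℝ) 1, HasDerivAt A₁ (A₁' u) u) (dB₁ : ∀ u ∈ Ioo (0:ℝ) 1, HasDerivAt B₁ (B₁' u) u)
    (h₁ : ∀ u ∈ Icc (0:ℝ) 1, A₁ u ^ 2 + B₁ u ^ 2 ≠ 0)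
    (hf₁ : ∀ u ∈ Icc (0:ℝ) 1, (A₁ u * B₁' u - A₁' u * B₁ u) / (A₁ u ^ 2 + B₁ u ^ 2) = f₁ u)
    (sA₂ : IsSemialgebraicFunOn ℚ S (fun z => A₂ (z 0))) (sB₂ : IsSemialgebraicFunOn ℚ S (fun z => B₂ (z 0)))
    (sA₂' : IsSemialgebraicFunOn ℚ S (fun z => A₂' (z 0)))
    (sB₂' : IsSemialgebraicFunOn ℚ S (fun z => B₂' (z 0)))
    (cA₂ : ContinuousOn A₂ (Icc (0:ℝ) 1)) (cB₂ : ContinuousOn B₂ (Icc (0:ℝ) 1))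
    (cA₂' : ContinuousOn A₂' (Icc (0:ℝ) 1)) (cB₂' : ContinuousOn B₂' (Icc (0:ℝ) 1))
    (dA₂ : ∀ u ∈ Ioo (0:ℝ) 1, HasDerivAt A₂ (A₂' u) u) (dB₂ : ∀ u ∈ Ioo (0:ℝ) 1, HasDerivAt B₂ (B₂' u) u)
    (h₂ : ∀ u ∈ Icc (0:ℝ) 1, A₂ u ^ 2 + B₂ u ^ 2 ≠ 0)
    (hf₂ : ∀ u ∈ Icc (0:ℝ) 1, (A₂ u * B₂' u - A₂' u * B₂ u) / (A₂ u ^ 2 + B₂ u ^ 2) = f₂ u) :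
    ∃ (P Q P' Q' : ℝ → ℝ),
      IsSemialgebraicFunOn ℚ S (fun z => P (z 0)) ∧ IsSemialgebraicFunOn ℚ S (fun z => Q (z 0)) ∧
      IsSemialgebraicFunOn ℚ S (fun z => P' (z 0)) ∧ IsSemialgebraicFunOn ℚ S (fun z => Q' (z 0)) ∧
      ContinuousOn P (Icc (0:ℝ) 1) ∧ ContinuousOn Q (Icc (0:ℝ) 1) ∧
      ContinuousOn P' (Icc (0:ℝ) 1) ∧ ContinuousOn Q' (Icc (0:ℝ) 1) ∧
      (∀ u ∈ Ioo (0:ℝ) 1, HasDerivAt P (P' u) u) ∧ (∀ u ∈ Ioo (0:ℝ) 1, HasDerivAt Q (Q' u) u) ∧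
      (∀ u ∈ Icc (0:ℝ) 1, P u ^ 2 + Q u ^ 2 ≠ 0) ∧
      ∀ u ∈ Icc (0:ℝ) 1, (P u * Q' u - P' u * Q u) / (P u ^ 2 + Q u ^ 2) = f₁ u + f₂ u := by
  refine ⟨fun u => A₁ u * A₂ u - B₁ u * B₂ u, fun u => A₁ u * B₂ u + B₁ u * A₂ u,
    fun u => A₁' u * A₂ u + A₁ u * A₂' u - (B₁' u * B₂ u + B₁ u * B₂' u),
    fun u => A₁' u * B₂ u + A₁ u * B₂' u + (B₁' u * A₂ u + B₁ u * A₂' u),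
    (sA₁.fun_mul sA₂).fun_sub (sB₁.fun_mul sB₂), (sA₁.fun_mul sB₂).fun_add (sB₁.fun_mul sA₂),
    ((sA₁'.fun_mul sA₂).fun_add (sA₁.fun_mul sA₂')).fun_sub
      ((sB₁'.fun_mul sB₂).fun_add (sB₁.fun_mul sB₂')),
    ((sA₁'.fun_mul sB₂).fun_add (sA₁.fun_mul sB₂')).fun_add
      ((sB₁'.fun_mul sA₂).fun_add (sB₁.fun_mul sA₂')),
    (cA₁.fun_mul cA₂).fun_sub (cB₁.fun_mul cB₂), (cA₁.fun_mul cB₂).fun_add (cB₁.fun_mul cA₂),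
    ((cA₁'.fun_mul cA₂).fun_add (cA₁.fun_mul cA₂')).fun_sub
      ((cB₁'.fun_mul cB₂).fun_add (cB₁.fun_mul cB₂')),
    ((cA₁'.fun_mul cB₂).fun_add (cA₁.fun_mul cB₂')).fun_add
      ((cB₁'.fun_mul cA₂).fun_add (cB₁.fun_mul cA₂')),
    fun u hu => ((dA₁ u hu).fun_mul (dA₂ u hu)).fun_sub ((dB₁ u hu).fun_mul (dB₂ u hu)),
    fun u hu => ((dA₁ u hu).fun_mul (dB₂ u hu)).fun_add ((dB₁ u hu).fun_mul (dA₂ u hu)),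
    fun u hu => ?_, fun u hu => ?_⟩
  · rw [saLoopZPow_mul_normSq]
    exact mul_ne_zero (h₁ u hu) (h₂ u hu)
  · rw [saLoopZPow_mul_ang _ _ _ _ _ _ _ _ (h₁ u hu) (h₂ u hu), hf₁ u hu, hf₂ u hu]

/-- Natural powers `(A + iB)ⁿ` of a loop of the class: again a loop of the class, with angular
derivative `n · (A B' − A' B)/(A² + B²)` on `[0,1]` (iterate the product, starting from the constant
loop `(1, 0)`). [folklore] -/
theorem saLoopZPow_exists_pow {S : Set (Fin 1 → ℝ)} (hS : IsSemialgebraic ℚ S)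
    {A B A' B' : ℝ → ℝ}
    (sA : IsSemialgebraicFunOn ℚ S (fun z => A (z 0))) (sB : IsSemialgebraicFunOn ℚ S (fun z => B (z 0)))
    (sA' : IsSemialgebraicFunOn ℚ S (fun z => A' (z 0))) (sB' : IsSemialgebraicFunOn ℚ S (fun z => B' (z 0)))
    (cA : ContinuousOn A (Icc (0:ℝ) 1)) (cB : ContinuousOn B (Icc (0:ℝ) 1))
    (cA' : ContinuousOn A' (Icc (0:ℝ) 1)) (cB' : ContinuousOn B' (Icc (0:ℝ) 1))
    (dA : ∀ u ∈ Ioo (0:ℝ) 1, HasDerivAt A (A' u) u) (dB : ∀ u ∈ Ioo (0:ℝ) 1, HasDerivAt B (B' u) u)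
    (h0 : ∀ u ∈ Icc (0:ℝ) 1, A u ^ 2 + B u ^ 2 ≠ 0) (n : ℕ) :
    ∃ (P Q P' Q' : ℝ → ℝ),
      IsSemialgebraicFunOn ℚ S (fun z => P (z 0)) ∧ IsSemialgebraicFunOn ℚ S (fun z => Q (z 0)) ∧
      IsSemialgebraicFunOn ℚ S (fun z => P' (z 0)) ∧ IsSemialgebraicFunOn ℚ S (fun z => Q' (z 0)) ∧
      ContinuousOn P (Icc (0:ℝ) 1) ∧ ContinuousOn Q (Icc (0:ℝ) 1) ∧
      ContinuousOn P' (Icc (0:ℝ) 1) ∧ ContinuousOn Q' (Icc (0:ℝ) 1) ∧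
      (∀ u ∈ Ioo (0:ℝ) 1, HasDerivAt P (P' u) u) ∧ (∀ u ∈ Ioo (0:ℝ) 1, HasDerivAt Q (Q' u) u) ∧
      (∀ u ∈ Icc (0:ℝ) 1, P u ^ 2 + Q u ^ 2 ≠ 0) ∧
      ∀ u ∈ Icc (0:ℝ) 1, (P u * Q' u - P' u * Q u) / (P u ^ 2 + Q u ^ 2) =
        (n : ℝ) * ((A u * B' u - A' u * B u) / (A u ^ 2 + B u ^ 2)) := by
  induction n with
  | zero => exact saLoopZPow_exists_const hS fun u _ => by simp
  | succ n ih =>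
    obtain ⟨P, Q, P', Q', sP, sQ, sP', sQ', cP, cQ, cP', cQ', dP, dQ, h0P, hfP⟩ := ih
    obtain ⟨P₁, Q₁, P₁', Q₁', sP₁, sQ₁, sP₁', sQ₁', cP₁, cQ₁, cP₁', cQ₁', dP₁, dQ₁, h0P₁, hfP₁⟩ :=
      saLoopZPow_exists_mul sP sQ sP' sQ' cP cQ cP' cQ' dP dQ h0P hfP sA sB sA' sB' cA cB cA' cB' dA dB h0
        (f₂ := fun u => (A u * B' u - A' u * B u) / (A u ^ 2 + B u ^ 2)) (fun u _ => rfl)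
    refine ⟨P₁, Q₁, P₁', Q₁', sP₁, sQ₁, sP₁', sQ₁', cP₁, cQ₁, cP₁', cQ₁', dP₁, dQ₁, h0P₁, fun u hu => ?_⟩
    rw [hfP₁ u hu, Nat.cast_succ]
    ring

/-- Integer powers of a loop `A + iB` of the class: for `N ≥ 0` the loop `(A + iB)^N`, for `N < 0` the
conjugate loop `(A − iB)^{−N}`; in both cases a loop of the class with angular derivative
`N · (A B' − A' B)/(A² + B²)` on `[0,1]`. [folklore] -/
theorem saLoopZPow_exists_zpow {S : Set (Fin 1 → ℝ)} (hS : IsSemialgebraic ℚ S)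
    {A B A' B' : ℝ → ℝ}
    (sA : IsSemialgebraicFunOn ℚ S (fun z => A (z 0))) (sB : IsSemialgebraicFunOn ℚ S (fun z => B (z 0)))
    (sA' : IsSemialgebraicFunOn ℚ S (fun z => A' (z 0))) (sB' : IsSemialgebraicFunOn ℚ S (fun z => B' (z 0)))
    (cA : ContinuousOn A (Icc (0:ℝ) 1)) (cB : ContinuousOn B (Icc (0:ℝ) 1))
    (cA' : ContinuousOn A' (Icc (0:ℝ) 1)) (cB' : ContinuousOn B' (Icc (0:ℝ) 1))
    (dA : ∀ u ∈ Ioo (0:ℝ) 1, HasDerivAt A (A' u) u) (dB : ∀ u ∈ Ioo (0:ℝ) 1, HasDerivAt B (B' u) u)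
    (h0 : ∀ u ∈ Icc (0:ℝ) 1, A u ^ 2 + B u ^ 2 ≠ 0) (N : ℤ) :
    ∃ (P Q P' Q' : ℝ → ℝ),
      IsSemialgebraicFunOn ℚ S (fun z => P (z 0)) ∧ IsSemialgebraicFunOn ℚ S (fun z => Q (z 0)) ∧
      IsSemialgebraicFunOn ℚ S (fun z => P' (z 0)) ∧ IsSemialgebraicFunOn ℚ S (fun z => Q' (z 0)) ∧
      ContinuousOn P (Icc (0:ℝ) 1) ∧ ContinuousOn Q (Icc (0:ℝ) 1) ∧
      ContinuousOn P' (Icc (0:ℝ) 1) ∧ ContinuousOn Q' (Icc (0:ℝ) 1) ∧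
      (∀ u ∈ Ioo (0:ℝ) 1, HasDerivAt P (P' u) u) ∧ (∀ u ∈ Ioo (0:ℝ) 1, HasDerivAt Q (Q' u) u) ∧
      (∀ u ∈ Icc (0:ℝ) 1, P u ^ 2 + Q u ^ 2 ≠ 0) ∧
      ∀ u ∈ Icc (0:ℝ) 1, (P u * Q' u - P' u * Q u) / (P u ^ 2 + Q u ^ 2) =
        (N : ℝ) * ((A u * B' u - A' u * B u) / (A u ^ 2 + B u ^ 2)) := by
  obtain ⟨n, rfl | rfl⟩ := Int.eq_nat_or_neg N
  · obtain ⟨P, Q, P', Q', sP, sQ, sP', sQ', cP, cQ, cP', cQ', dP, dQ, h0P, hfP⟩ :=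
      saLoopZPow_exists_pow hS sA sB sA' sB' cA cB cA' cB' dA dB h0 n
    exact ⟨P, Q, P', Q', sP, sQ, sP', sQ', cP, cQ, cP', cQ', dP, dQ, h0P, fun u hu => by
      rw [hfP u hu, Int.cast_natCast]⟩
  · obtain ⟨P, Q, P', Q', sP, sQ, sP', sQ', cP, cQ, cP', cQ', dP, dQ, h0P, hfP⟩ :=
      saLoopZPow_exists_pow hS sA sB sA' sB' cA cB cA' cB' dA dB h0 n
    refine ⟨P, fun u => -Q u, P', fun u => -Q' u, sP, sQ.fun_neg, sP', sQ'.fun_neg, cP, cQ.fun_neg,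
      cP', cQ'.fun_neg, dP, fun u hu => (dQ u hu).fun_neg, fun u hu => ?_, fun u hu => ?_⟩
    · rw [neg_sq]
      exact h0P u hu
    · rw [saLoopZPow_conj_ang, hfP u hu, Int.cast_neg, Int.cast_natCast]
      ring

/-! ## The stub -/

/-- STUB (rung 10, X8) **integer powers of semialgebraic `C¹` loops.** Given finitely many zero-free
loops `Aₖ + iBₖ` on `[0,1]` (`Aₖ, Bₖ` continuous on `[0,1]`, `ℚ`-semialgebraic on the cube of `ℝ¹`,
with derivatives `Aₖ'`, `Bₖ'` on `(0,1)` of the same regularity, `Aₖ² + Bₖ² ≠ 0` on `[0,1]`) and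
integers `Nₖ`, there is one zero-free loop `P + iQ` of the same class (with derivative data `P', Q'`)
whose angular derivative `(P Q' − P' Q)/(P² + Q²)` equals `Σₖ Nₖ · (Aₖ Bₖ' − Aₖ' Bₖ)/(Aₖ² + Bₖ²)` on
`[0,1]` (`P + iQ = Πₖ (Aₖ + iBₖ)^{[Nₖ]}` with `z^{[N]} = z^N` for `N ≥ 0` and `(conj z)^{−N}` for
`N < 0`; induction on the number of loops). [folklore] -/
theorem stub_saLoopZPow :
    ∀ (s : ℕ) (A B A' B' : Fin s → ℝ → ℝ) (N : Fin s → ℤ),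
      (∀ k, IsSemialgebraicFunOn ℚ (Set.pi Set.univ (fun _ : Fin 1 => Set.Icc (0:ℝ) 1)) (fun z => A k (z 0))) → (∀ k, IsSemialgebraicFunOn ℚ (Set.pi Set.univ (fun _ : Fin 1 => Set.Icc (0:ℝ) 1)) (fun z => B k (z 0))) →
      (∀ k, IsSemialgebraicFunOn ℚ (Set.pi Set.univ (fun _ : Fin 1 => Set.Icc (0:ℝ) 1)) (fun z => A' k (z 0))) → (∀ k, IsSemialgebraicFunOn ℚ (Set.pi Set.univ (fun _ : Fin 1 => Set.Icc (0:ℝ) 1)) (fun z => B' k (z 0))) →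
      (∀ k, ContinuousOn (A k) (Set.Icc (0:ℝ) 1)) → (∀ k, ContinuousOn (B k) (Set.Icc (0:ℝ) 1)) →
      (∀ k, ContinuousOn (A' k) (Set.Icc (0:ℝ) 1)) → (∀ k, ContinuousOn (B' k) (Set.Icc (0:ℝ) 1)) →
      (∀ k, ∀ u ∈ Set.Ioo (0:ℝ) 1, HasDerivAt (A k) (A' k u) u) → (∀ k, ∀ u ∈ Set.Ioo (0:ℝ) 1, HasDerivAt (B k) (B' k u) u) →
      (∀ k, ∀ u ∈ Set.Icc (0:ℝ) 1, A k u ^ 2 + B k u ^ 2 ≠ 0) →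
      ∃ (P Q P' Q' : ℝ → ℝ),
        IsSemialgebraicFunOn ℚ (Set.pi Set.univ (fun _ : Fin 1 => Set.Icc (0:ℝ) 1)) (fun z => P (z 0)) ∧ IsSemialgebraicFunOn ℚ (Set.pi Set.univ (fun _ : Fin 1 => Set.Icc (0:ℝ) 1)) (fun z => Q (z 0)) ∧
        IsSemialgebraicFunOn ℚ (Set.pi Set.univ (fun _ : Fin 1 => Set.Icc (0:ℝ) 1)) (fun z => P' (z 0)) ∧ IsSemialgebraicFunOn ℚ (Set.pi Set.univ (fun _ : Fin 1 => Set.Icc (0:ℝ) 1)) (fun z => Q' (z 0)) ∧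
        ContinuousOn P (Set.Icc (0:ℝ) 1) ∧ ContinuousOn Q (Set.Icc (0:ℝ) 1) ∧
        ContinuousOn P' (Set.Icc (0:ℝ) 1) ∧ ContinuousOn Q' (Set.Icc (0:ℝ) 1) ∧
        (∀ u ∈ Set.Ioo (0:ℝ) 1, HasDerivAt P (P' u) u) ∧ (∀ u ∈ Set.Ioo (0:ℝ) 1, HasDerivAt Q (Q' u) u) ∧
        (∀ u ∈ Set.Icc (0:ℝ) 1, P u ^ 2 + Q u ^ 2 ≠ 0) ∧
        ∀ u ∈ Set.Icc (0:ℝ) 1, (P u * Q' u - P' u * Q u) / (P u ^ 2 + Q u ^ 2) =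
          ∑ k, (N k : ℝ) * ((A k u * B' k u - A' k u * B k u) / (A k u ^ 2 + B k u ^ 2)) := by
  have hS := isSemialgebraic_cubePi_one
  intro s
  induction s with
  | zero =>
    intro A B A' B' N _ _ _ _ _ _ _ _ _ _ _
    exact saLoopZPow_exists_const hS fun u _ => by simp
  | succ s ih =>
    intro A B A' B' N sA sB sA' sB' cA cB cA' cB' dA dB h0
    obtain ⟨P₁, Q₁, P₁', Q₁', sP₁, sQ₁, sP₁', sQ₁', cP₁, cQ₁, cP₁', cQ₁', dP₁, dQ₁, h0₁, hf₁⟩ :=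
      ih (fun k => A (Fin.castSucc k)) (fun k => B (Fin.castSucc k)) (fun k => A' (Fin.castSucc k))
        (fun k => B' (Fin.castSucc k)) (fun k => N (Fin.castSucc k)) (fun k => sA _) (fun k => sB _)
        (fun k => sA' _) (fun k => sB' _) (fun k => cA _) (fun k => cB _) (fun k => cA' _) (fun k => cB' _)
        (fun k => dA _) (fun k => dB _) (fun k => h0 _)
    obtain ⟨P₂, Q₂, P₂', Q₂', sP₂, sQ₂, sP₂', sQ₂', cP₂, cQ₂, cP₂', cQ₂', dP₂, dQ₂, h0₂, hf₂⟩ :=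
      saLoopZPow_exists_zpow hS (sA (Fin.last s)) (sB (Fin.last s)) (sA' (Fin.last s)) (sB' (Fin.last s))
        (cA (Fin.last s)) (cB (Fin.last s)) (cA' (Fin.last s)) (cB' (Fin.last s)) (dA (Fin.last s))
        (dB (Fin.last s)) (h0 (Fin.last s)) (N (Fin.last s))
    obtain ⟨P, Q, P', Q', sP, sQ, sP', sQ', cP, cQ, cP', cQ', dP, dQ, h0P, hfP⟩ :=
      saLoopZPow_exists_mul sP₁ sQ₁ sP₁' sQ₁' cP₁ cQ₁ cP₁' cQ₁' dP₁ dQ₁ h0₁ hf₁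
        sP₂ sQ₂ sP₂' sQ₂' cP₂ cQ₂ cP₂' cQ₂' dP₂ dQ₂ h0₂ hf₂
    refine ⟨P, Q, P', Q', sP, sQ, sP', sQ', cP, cQ, cP', cQ', dP, dQ, h0P, fun u hu => ?_⟩
    rw [hfP u hu, Fin.sum_univ_castSucc]

end Summit.KontsevichZagierPeriods.KontsevichZagierPeriods.Cruxes.StokesGeneration.FibrewiseStokes

end
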